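import Literature.Computability.FineGrained.KSatExponentGapProofs
import Literature.Computability.FineGrained.SparsificationAlgorithm
import Literature.Computability.Complexity.TM2FlatMapList
import Literature.Computability.Complexity.Transducers
import HarnessLib

/-!
# Impagliazzo–Paturi, Lemma 2: lifting a one-formula renaming machine to the list fact

Family `fine-grained` (trunk T-CPLX-FINE). After `SparsificationAlgorithm.lean`
(`sparsification_holds`) the whole chain

  `ipRename_reduceList_computable` ⟹ `impagliazzoPaturi_lemma2` (IP 2001, Lemma 2)
  ⟹ `satExponent_le_satExponentLimit` (IP 2001, Theorem 3) ⟹ `ETH.frequently_satExponent_lt`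

(`KSatExponentGapProofs.lean`, `SATBruteForceMachine.lean`) hangs on ONE machine fact,
`Literature.Computability.FineGrained.ipRename_reduceList_computable` (`IPLemma2Assembly.lean`):
a multi-stack machine mapping the encoding of a LIST of k-CNFs to the encoding of the
concatenation of their renaming reductions `IPRename.reduceList` within a time that is a sum,
over the list, of `(m+1)^{n/m} · poly(L, n)` per formula. This file proves, once and for all,
the two pieces of machine plumbing between that fact and the construction of a stack program
for ONE formula (the renaming machine proper, `IPRenameRoutines.lean`, `IPRenameLoops.lean` and
its sequels), so that the remaining work is exactly:

  *a machine computing `ψ ↦ KCNF.encodeList (IPRename.reduceList k cap len ⌈a n/b⌉ ψ)` from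
  `KCNF.encode ψ` within `c · (m+1)^{n/m} · (L + n + 1)^c + c` steps*

(`ipRename_reduceList_computable_of_single`; the hypothesis is spelled out, not named, so as
not to create a second named fact for the same construction). The two pieces:

* **list lift** (`ipRename_reduceList_computable_of_single`): run the one-formula machine on
  every blank-terminated entry of the input list and concatenate the outputs — the machine
  `Turing.TM2ComputableAux.flatMapMachine` of `TM2FlatMapList.lean` behind a linear-time copy
  of the input (`MachineLift.mapFST`), with the additive running time converted to the printed
  shape using the output-size bound `length_encodeList_reduceList_le`
  (`≤ 2^{numCols} (m+1)^{n/m+1} · 4 (2^{k'}(k'+2)+1) (L+n+1)²`, from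
  `IPRename.length_reduceList_le`, `IPRename.length_clauses_reduce_le`, `KCNF.length_encode_le`);
* **alphabet change** (`MachineLift.computesInTime_of_embedding`): a machine over a larger work
  alphabet `Γ` computing between the *embedded* encodings (`List.map emb`, `emb : Γ₀ → Γ` with a
  partial inverse) yields a machine over `Γ₀` for the encodings themselves, at an additive
  linear cost (two one-state transducers, `Transducers.lean`, around the given machine,
  `Turing.TM2ComputableAux.comp_outputsWithin`) — stack programs of `SymbolPrograms.lean` run
  over one alphabet, which for a parser of `KCNF.encode` is conveniently larger than `Γ'`.

Consequences recorded: `impagliazzoPaturi_lemma2_of_single`,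
`satExponent_le_satExponentLimit_of_single`, `ETH.frequently_satExponent_lt_of_single`.

## References

* R. Impagliazzo, R. Paturi, *On the complexity of k-SAT*, J. Comput. System Sci. 62 (2001)
  367–375, Lemma 2 (p. 373, the "Moreover" sentence: the reduction is computable in time
  `poly(n) 2^{2εn}`), Theorem 3 (p. 374).
* S. Arora, B. Barak, *Computational Complexity: A Modern Approach*, CUP 2009, §1.3
  (multi-tape machine constructions: subroutines, alphabet reduction), Claim 1.5–1.6.
-/

namespace Literature.Computability.FineGrained

open _root_.Computability Turing Complexity

namespace MachineLift

/-! ### One-state transducers: letter-to-word maps are linear time -/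

/-- The one-state transducer applying a letter-to-word map `g` to every symbol. [folklore] -/
def mapFST {Γ₀ Γ₁ : Type} (g : Γ₀ → List Γ₁) : FST Unit Γ₀ Γ₁ where
  init := ()
  step := fun _ a => ((), g a)
  front := fun _ => []
  keep := fun _ => true

/-- The run of `mapFST g` emits `l.flatMap g`. [folklore] -/
theorem mapFST_run {Γ₀ Γ₁ : Type} (g : Γ₀ → List Γ₁) (l : List Γ₀) :
    ((mapFST g).run () l).2 = l.flatMap g := by
  induction l with
  | nil => rfl
  | cons a l ih =>
    rw [FST.run_cons, List.flatMap_cons]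
    show g a ++ ((mapFST g).run () l).2 = g a ++ l.flatMap g
    rw [ih]

/-- `mapFST g` computes `l ↦ l.flatMap g`. [folklore] -/
theorem mapFST_eval {Γ₀ Γ₁ : Type} (g : Γ₀ → List Γ₁) (l : List Γ₀) :
    (mapFST g).eval l = l.flatMap g := by
  have hi : (mapFST g).init = () := rfl
  rw [FST.eval, hi, mapFST_run]
  rfl

/-- The emission bound of `mapFST g` is the longest `g a`. [folklore] -/
theorem mapFST_maxEmit_le {Γ₀ Γ₁ : Type} [Fintype Γ₀] (g : Γ₀ → List Γ₁) {E : ℕ}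
    (hg : ∀ a, (g a).length ≤ E) : (mapFST g).maxEmit ≤ E := by
  unfold FST.maxEmit
  exact Finset.sup_le fun p _ => hg p.2

/-- **Letter-to-word maps are linear time** on Mathlib's multi-stack machines: some machine
maps every word `l` to `l.flatMap g` within `(E + 1) |l| + 3` steps, `E` bounding `|g a|`.
[cite: AroraBarak2009, §1.3 (Claim 1.5: alphabet reduction by transducing symbols)] -/
theorem exists_outputsWithin_flatMap {Γ₀ Γ₁ : Type} [Fintype Γ₀] [Fintype Γ₁] (g : Γ₀ → List Γ₁)
    {E : ℕ} (hg : ∀ a, (g a).length ≤ E) :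
    ∃ M : TM2ComputableAux Γ₀ Γ₁, ∀ l : List Γ₀, M.OutputsWithin l (l.flatMap g) ((E + 1) * l.length + 3) := by
  obtain ⟨M, hM⟩ := (mapFST g).timeComputable_eval
  refine ⟨M, fun l => ?_⟩
  have h := hM l
  rw [mapFST_eval] at h
  refine h.mono ?_
  have := mapFST_maxEmit_le g hg
  simp only [id]
  exact Nat.add_le_add_right (Nat.mul_le_mul_right _ (by omega)) _

/-- A linear-time copying machine (the identity as a transduction). [folklore] -/
theorem exists_outputsWithin_copy (Γ₀ : Type) [Fintype Γ₀] :
    ∃ M : TM2ComputableAux Γ₀ Γ₀, ∀ l : List Γ₀, M.OutputsWithin l l (2 * l.length + 3) := by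
  obtain ⟨M, hM⟩ := exists_outputsWithin_flatMap (fun a : Γ₀ => [a]) (E := 1) (fun _ => le_rfl)
  refine ⟨M, fun l => ?_⟩
  have h := hM l
  rwa [show l.flatMap (fun a => [a]) = l by induction l <;> simp_all] at h

/-! ### Changing the work alphabet -/

/-- **Alphabet change at linear additive cost.** Let `emb : Γ₀ → Γ` embed the alphabet of the
encodings into a work alphabet, with a partial inverse `proj`. If a machine over `Γ` maps the
embedded input `(ea a).map emb` to the embedded output `(eb (f a)).map emb` within `T a` steps,
then a machine over `Γ₀` maps `ea a` to `eb (f a)` within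
`T a + 2 |ea a| + 2 |eb (f a)| + 6` steps (transduce in, run, transduce out).
[cite: AroraBarak2009, §1.3 (Claim 1.5, alphabet reduction; composition of machines)] -/
theorem computesInTime_of_embedding {α β Γ₀ Γ : Type} [Fintype Γ₀] [Fintype Γ] (emb : Γ₀ → Γ)
    (proj : Γ → Option Γ₀) (hpe : ∀ a, proj (emb a) = some a) {ea : α → List Γ₀}
    {eb : β → List Γ₀} {f : α → β} {T : α → ℕ}
    (h : ComputesInTime (fun a => (ea a).map emb) (fun b => (eb b).map emb) f T) :
    ComputesInTime ea eb f fun a => T a + 2 * (ea a).length + 2 * (eb (f a)).length + 6 := by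
  obtain ⟨M, hM⟩ := h
  obtain ⟨Mi, hMi⟩ := exists_outputsWithin_flatMap (fun a : Γ₀ => [emb a]) (E := 1) (fun _ => le_rfl)
  obtain ⟨Mo, hMo⟩ := exists_outputsWithin_flatMap (fun s : Γ => (proj s).toList) (E := 1)
    (fun s => by cases proj s <;> simp)
  refine ⟨(Mi.comp M).comp Mo, fun a => ?_⟩
  have e1 : (ea a).flatMap (fun x => [emb x]) = (ea a).map emb := by
    induction ea a <;> simp_all
  have e2 : ((eb (f a)).map emb).flatMap (fun s => (proj s).toList) = eb (f a) := by
    induction eb (f a) <;> simp_all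
  have h1 := hMi (ea a)
  rw [e1] at h1
  have h12 := TM2ComputableAux.comp_outputsWithin Mi M h1 ⟨Classical.choice (hM a)⟩
  have h3 := hMo ((eb (f a)).map emb)
  rw [e2] at h3
  have h123 := TM2ComputableAux.comp_outputsWithin (Mi.comp M) Mo h12 h3
  refine ⟨Classical.choice (h123.mono ?_)⟩
  simp only [List.length_map]
  omega

end MachineLift

/-! ### The size of the renaming reduction's output -/

namespace KCNF

variable {k : ℕ}

/-- The length of the encoding of a list of formulas: the encodings plus one separator each.
[folklore] -/
theorem length_encodeList {k : ℕ} (l : List (KCNF k)) :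
    (encodeList l).length = (l.map fun φ => φ.encode.length + 1).sum := by
  induction l with
  | nil => rfl
  | cons φ l ih => simp [encodeList, List.flatMap_cons] at ih ⊢; omega

end KCNF

namespace IPRename

/-- The number of block indices of a partition is at most the number of variables
(`numBlocks = |B| ≤ |occurring variables| ≤ numVars`). [folklore] -/
theorem numBlocks_le_numVars {k : ℕ} (P : Params) (φ : KCNF k) :
    numBlocks P φ.clauses ≤ φ.numVars := by
  unfold numBlocks bList
  calc ((occList φ.clauses).filter (inB P φ.clauses)).length ≤ (occList φ.clauses).length :=
        List.length_filter_le _ _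
    _ = (occVars φ.clauses).card := length_occList _
    _ ≤ φ.numVars := card_occVars_le φ

/-- **Size of one disjunct.** Every member of `reduceList k cap len t ψ` is encoded by at most
`4 (2^{k'} (k' + 2) + 1) (L + n + 1)²` symbols (`k' = kOut k cap len`, `L = |encode ψ|`,
`n = numVars ψ`): it has at most `n` variables and at most `2^{k'} (|clauses| + n)` clauses of
width `≤ k'`. [folklore] -/
theorem length_encode_le_of_mem_reduceList {k cap len t : ℕ} {ψ : KCNF k}
    {Φ : KCNF (kOut k cap len)} (hΦ : Φ ∈ reduceList k cap len t ψ) :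
    Φ.encode.length + 1 ≤
      4 * (2 ^ kOut k cap len * (kOut k cap len + 2) + 1) * (ψ.encode.length + ψ.numVars + 1) ^ 2 := by
  obtain ⟨bs, -, fv, -, -, rfl⟩ := mem_reduceList.1 hΦ
  set P : Params := ⟨cap, len, maskOf bs, fv⟩
  -- the three size parameters of the disjunct
  have hn : (reduce P ψ).numVars ≤ ψ.numVars := by rw [numVars_reduce]; exact Nat.sub_le _ _
  have hc : (reduce P ψ).clauses.length ≤ 2 ^ kOut k cap len * (ψ.encode.length + ψ.numVars) := by
    refine (length_clauses_reduce_le P ψ).trans (Nat.mul_le_mul_left _ ?_)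
    exact Nat.add_le_add (KCNF.length_clauses_le_length_encode ψ) (numBlocks_le_numVars P ψ)
  have h1 : (reduce P ψ).encode.length ≤ (reduce P ψ).numVars + 1 +
      (reduce P ψ).clauses.length * (kOut k cap len * ((reduce P ψ).numVars + 2) + 2) :=
    KCNF.length_encode_le (reduce P ψ)
  -- elementary estimate in the abbreviations K, N = L + n, with n' ≤ N, C ≤ 2^K N
  generalize (reduce P ψ).encode.length = E at h1 ⊢
  generalize (reduce P ψ).clauses.length = C at hc h1 ⊢
  generalize (reduce P ψ).numVars = n' at hn h1 ⊢
  generalize ψ.encode.length = L at hc ⊢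
  generalize ψ.numVars = n at hn hc ⊢
  generalize kOut k cap len = K at hc h1 ⊢
  have h2 : C * (K * (n' + 2) + 2) ≤ 2 ^ K * (L + n) * (K * (L + n + 2) + 2) :=
    Nat.mul_le_mul hc (by nlinarith)
  have h3 : 2 ^ K * (L + n) * (K * (L + n + 2) + 2) ≤ 2 ^ K * (K + 2) * (L + n + 2) ^ 2 := by
    have h3a : K * (L + n + 2) + 2 ≤ (K + 2) * (L + n + 2) := by nlinarith
    calc 2 ^ K * (L + n) * (K * (L + n + 2) + 2) ≤ 2 ^ K * (L + n + 2) * ((K + 2) * (L + n + 2)) :=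
          Nat.mul_le_mul (Nat.mul_le_mul_left _ (by omega)) h3a
      _ = 2 ^ K * (K + 2) * (L + n + 2) ^ 2 := by ring
  have h4 : (L + n + 2) ^ 2 ≤ 4 * (L + n + 1) ^ 2 := by nlinarith
  have h5 : n' + 1 + 1 ≤ (L + n + 2) ^ 2 := by nlinarith
  have h23 := h2.trans h3
  calc E + 1 ≤ (L + n + 2) ^ 2 + 2 ^ K * (K + 2) * (L + n + 2) ^ 2 := by omega
    _ = (2 ^ K * (K + 2) + 1) * (L + n + 2) ^ 2 := by ring
    _ ≤ (2 ^ K * (K + 2) + 1) * (4 * (L + n + 1) ^ 2) := Nat.mul_le_mul_left _ h4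
    _ = 4 * (2 ^ K * (K + 2) + 1) * (L + n + 1) ^ 2 := by ring

/-- **Size of the whole output.** The encoding of the list `reduceList k cap len t ψ` has
length at most `2^{numCols} (m+1)^{n/m + 1} · 4 (2^{k'}(k'+2)+1) (L+n+1)²` (`m = max len 1`).
[folklore] -/
theorem length_encodeList_reduceList_le (k cap len t : ℕ) (ψ : KCNF k) :
    (KCNF.encodeList (reduceList k cap len t ψ)).length ≤
      2 ^ numCols k cap * (max len 1 + 1) ^ (ψ.numVars / max len 1 + 1) *
        (4 * (2 ^ kOut k cap len * (kOut k cap len + 2) + 1) * (ψ.encode.length + ψ.numVars + 1) ^ 2) := by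
  rw [KCNF.length_encodeList]
  set Bnd := 4 * (2 ^ kOut k cap len * (kOut k cap len + 2) + 1) *
    (ψ.encode.length + ψ.numVars + 1) ^ 2
  have hb : ∀ x ∈ (reduceList k cap len t ψ).map (fun φ => φ.encode.length + 1), x ≤ Bnd := by
    intro x hx
    obtain ⟨Φ, hΦ, rfl⟩ := List.mem_map.1 hx
    exact length_encode_le_of_mem_reduceList hΦ
  have h := List.sum_le_card_nsmul _ Bnd hb
  rw [List.length_map, smul_eq_mul] at h
  exact h.trans (Nat.mul_le_mul_right _ (length_reduceList_le k cap len t ψ))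

end IPRename

/-! ### The list fact from a one-formula machine -/

/-- `encodeList` of a concatenation of lists is the concatenation of the `encodeList`s of the
pieces. [folklore] -/
theorem KCNF.encodeList_flatMap {k k' : ℕ} (l : List (KCNF k)) (R : KCNF k → List (KCNF k')) :
    KCNF.encodeList (l.flatMap R) = l.flatMap fun ψ => KCNF.encodeList (R ψ) := by
  simp [KCNF.encodeList, List.flatMap_assoc]

/-- Elementary: `X_e = (m+1)^{q} (B+1)^e` is monotone in `e` and at least `1`. [folklore] -/
theorem pow_mul_pow_mono {M q B e e' : ℕ} (hM : 1 ≤ M) (he : e ≤ e') :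
    1 ≤ M ^ q * (B + 1) ^ e ∧ M ^ q * (B + 1) ^ e ≤ M ^ q * (B + 1) ^ e' :=
  ⟨Nat.one_le_iff_ne_zero.2 (Nat.mul_ne_zero (pow_ne_zero _ (by omega)) (pow_ne_zero _ (by omega))),
    Nat.mul_le_mul_left _ (Nat.pow_le_pow_right (by omega) he)⟩

/-- **The list fact from a one-formula machine.** If, for all parameters, some machine maps
`KCNF.encode ψ` to `KCNF.encodeList (IPRename.reduceList k cap len ⌈a·n/b⌉ ψ)` within
`c · (m+1)^{n/m} · (L + n + 1)^c + c` steps (`n = numVars ψ`, `L = |encode ψ|`, `m = max len 1`),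
then `ipRename_reduceList_computable` holds: the list version runs that machine on every
blank-terminated entry of the input (`TM2FlatMapList.lean`) behind a linear-time copy of the
input, and the per-entry overhead `2 L + 2 |output| + 3` is of the same shape by
`IPRename.length_encodeList_reduceList_le`.
[cite: ImpagliazzoPaturiJCSS2001, Lemma 2 (p. 373), the "Moreover" sentence] -/
theorem ipRename_reduceList_computable_of_single
    (h : ∀ (k cap len a b : ℕ), 0 < b → ∃ c : ℕ,
      ComputesInTime KCNF.encode KCNF.encodeList
        (fun ψ : KCNF k => IPRename.reduceList k cap len (ipThreshold a b ψ.numVars) ψ)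
        fun ψ => c * ((max len 1 + 1) ^ (ψ.numVars / max len 1) *
          (ψ.encode.length + ψ.numVars + 1) ^ c) + c) :
    ipRename_reduceList_computable := by
  intro k cap len a b hb
  obtain ⟨c, M₂, hM₂⟩ := h k cap len a b hb
  obtain ⟨M₁, hM₁⟩ := MachineLift.exists_outputsWithin_copy Γ'
  set m := max len 1 with hm
  set R : KCNF k → List (KCNF (IPRename.kOut k cap len)) :=
    fun ψ => IPRename.reduceList k cap len (ipThreshold a b ψ.numVars) ψ with hR
  -- constants
  set D : ℕ := 2 ^ IPRename.numCols k cap * (m + 1) *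
    (4 * (2 ^ IPRename.kOut k cap len * (IPRename.kOut k cap len + 2) + 1)) with hD
  set C : ℕ := 2 * c + 2 * D + 16 with hC
  refine ⟨C, M₁.flatMapMachine M₂ Γ'.blank, fun l => ?_⟩
  -- the flat-map machine
  have h₁ : M₁.OutputsWithin (KCNF.encodeList l) (l.flatMap fun ψ => ψ.encode ++ [Γ'.blank])
      (2 * (KCNF.encodeList l).length + 3) := hM₁ _
  have hrun := TM2ComputableAux.flatMap_outputsWithin M₁ M₂ (sep := Γ'.blank) (w := KCNF.encode)
    (y := fun ψ => KCNF.encodeList (R ψ))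
    (m := fun ψ => c * ((m + 1) ^ (ψ.numVars / m) * (ψ.encode.length + ψ.numVars + 1) ^ c) + c)
    (fun ψ => ψ.blank_not_mem_encode) (bs := l) h₁ (fun ψ => ⟨Classical.choice (hM₂ ψ)⟩)
  rw [← KCNF.encodeList_flatMap] at hrun
  refine ⟨Classical.choice (hrun.mono ?_)⟩
  -- the time bound, entry by entry
  rw [KCNF.length_encodeList]
  set X : KCNF k → ℕ := fun ψ => (m + 1) ^ (ψ.numVars / m) * (ψ.encode.length + ψ.numVars + 1) ^ C
    with hX
  have hper : ∀ ψ : KCNF k, 2 * (ψ.encode.length + 1) +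
      (c * ((m + 1) ^ (ψ.numVars / m) * (ψ.encode.length + ψ.numVars + 1) ^ c) + c +
        2 * ψ.encode.length + 2 * (KCNF.encodeList (R ψ)).length + 3) ≤ C * X ψ := by
    intro ψ
    set n := ψ.numVars
    set L := ψ.encode.length
    have hm1 : 1 ≤ m + 1 := by omega
    obtain ⟨hX1, hXc⟩ := pow_mul_pow_mono (M := m + 1) (q := n / m) (B := L + n) (e := c) (e' := C)
      hm1 (by omega)
    obtain ⟨-, hX2⟩ := pow_mul_pow_mono (M := m + 1) (q := n / m) (B := L + n) (e := 2) (e' := C)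
      hm1 (by omega)
    obtain ⟨-, hX1'⟩ := pow_mul_pow_mono (M := m + 1) (q := n / m) (B := L + n) (e := 1) (e' := C)
      hm1 (by omega)
    have hL : L + 1 ≤ (m + 1) ^ (n / m) * (L + n + 1) ^ 1 := by
      rw [pow_one]
      calc L + 1 ≤ 1 * (L + n + 1) := by omega
        _ ≤ (m + 1) ^ (n / m) * (L + n + 1) :=
          Nat.mul_le_mul_right _ (Nat.one_le_pow _ _ (by omega))
    have hY := IPRename.length_encodeList_reduceList_le k cap len (ipThreshold a b n) ψ
    have hY' : (KCNF.encodeList (R ψ)).length ≤ D * ((m + 1) ^ (n / m) * (L + n + 1) ^ 2) := by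
      refine hY.trans (le_of_eq ?_)
      simp only [hD, pow_succ]
      ring
    -- assemble
    have e1 : (m + 1) ^ (n / m) * (L + n + 1) ^ C = X ψ := rfl
    rw [← e1]
    set Z := (m + 1) ^ (n / m) * (L + n + 1) ^ C with hZ
    have a1 : c * ((m + 1) ^ (n / m) * (L + n + 1) ^ c) ≤ c * Z := Nat.mul_le_mul_left _ hXc
    have a2 : 2 * (KCNF.encodeList (R ψ)).length ≤ 2 * D * Z := by
      rw [Nat.mul_assoc]; exact Nat.mul_le_mul_left _ (hY'.trans (Nat.mul_le_mul_left _ hX2))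
    have a3 : L + 1 ≤ Z := hL.trans hX1'
    have a4 : 1 ≤ Z := hX1.trans hXc
    rw [hC]
    nlinarith
  have hsum : (l.map fun ψ => 2 * (ψ.encode.length + 1) +
      (c * ((m + 1) ^ (ψ.numVars / m) * (ψ.encode.length + ψ.numVars + 1) ^ c) + c +
        2 * ψ.encode.length + 2 * (KCNF.encodeList (R ψ)).length + 3)).sum ≤
      (l.map fun ψ => C * X ψ).sum :=
    List.sum_le_sum (fun ψ _ => hper ψ)
  have hmulsum : (l.map fun ψ => C * X ψ).sum = C * (l.map X).sum := by
    rw [List.sum_map_mul_left]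
  have h2sum : 2 * (l.map fun φ => φ.encode.length + 1).sum =
      (l.map fun φ => 2 * (φ.encode.length + 1)).sum := by
    rw [List.sum_map_mul_left]
  rw [List.sum_map_add, hmulsum] at hsum
  rw [h2sum]
  have hC6 : 6 ≤ C := by omega
  show _ ≤ C * (l.map X).sum + C
  omega

/-! ### Consequences -/

/-- **Impagliazzo–Paturi 2001, Lemma 2, from a one-formula renaming machine** (the
sparsification algorithm being a theorem, `sparsification_holds`).
[cite: ImpagliazzoPaturiJCSS2001, Lemma 2 (p. 373)] -/
theorem impagliazzoPaturi_lemma2_of_single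
    (h : ∀ (k cap len a b : ℕ), 0 < b → ∃ c : ℕ,
      ComputesInTime KCNF.encode KCNF.encodeList
        (fun ψ : KCNF k => IPRename.reduceList k cap len (ipThreshold a b ψ.numVars) ψ)
        fun ψ => c * ((max len 1 + 1) ^ (ψ.numVars / max len 1) *
          (ψ.encode.length + ψ.numVars + 1) ^ c) + c) :
    impagliazzoPaturi_lemma2 :=
  impagliazzoPaturi_lemma2_of_machines sparsification_holds (ipRename_reduceList_computable_of_single h)

/-- **Impagliazzo–Paturi 2001, Theorem 3 (`s_k ≤ (1 - d/k) s_∞`), from a one-formula renaming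
machine.** [cite: ImpagliazzoPaturiJCSS2001, Theorem 3 (p. 374)] -/
theorem satExponent_le_satExponentLimit_of_single
    (h : ∀ (k cap len a b : ℕ), 0 < b → ∃ c : ℕ,
      ComputesInTime KCNF.encode KCNF.encodeList
        (fun ψ : KCNF k => IPRename.reduceList k cap len (ipThreshold a b ψ.numVars) ψ)
        fun ψ => c * ((max len 1 + 1) ^ (ψ.numVars / max len 1) *
          (ψ.encode.length + ψ.numVars + 1) ^ c) + c) :
    satExponent_le_satExponentLimit :=
  satExponent_le_satExponentLimit_of_two_machines sparsification_holds
    (ipRename_reduceList_computable_of_single h)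

/-- **"Assuming ETH, `(s_k)` increases infinitely often", from a one-formula renaming machine.**
[cite: ImpagliazzoPaturiJCSS2001, abstract and p. 369 (consequence of Theorem 3)] -/
theorem ETH.frequently_satExponent_lt_of_single
    (h : ∀ (k cap len a b : ℕ), 0 < b → ∃ c : ℕ,
      ComputesInTime KCNF.encode KCNF.encodeList
        (fun ψ : KCNF k => IPRename.reduceList k cap len (ipThreshold a b ψ.numVars) ψ)
        fun ψ => c * ((max len 1 + 1) ^ (ψ.numVars / max len 1) *
          (ψ.encode.length + ψ.numVars + 1) ^ c) + c) :
    ETH.frequently_satExponent_lt :=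
  ETH.frequently_satExponent_lt_of_satExponent_le_satExponentLimit
    (satExponent_le_satExponentLimit_of_single h)

end Literature.Computability.FineGrained
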